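import Literature.AlgebraicGeometry.ModuliOfSheaves.KummerModuliSpacesOfSheaves
import Literature.AlgebraicGeometry.HilbertScheme.ChernCharacterOperators
import HarnessLib

/-!
# Markman 2002, Cor. 2 — the Künneth factors of the Chern classes of a universal sheaf GENERATE the cohomology ring of a complete moduli space of stable sheaves on a K3 or abelian surface (one NAMED FACT + kernel)

Layer `Literature/AlgebraicGeometry/ModuliOfSheaves`.  Typed for the cross-ladder literature-typing layer
(D-0088(4), tranche LT-H4, seat `hodge-lit-oqh-1` gen 8; ladder HodgeAV rungs №2 ∕ H3).  This is "Markman's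
Theorem" of Floccari–Fu–Zhang, Commun. Contemp. Math. 23 (2021) Rem. 3.5 ∕ 4.8 ("the missing ingredient is
the analogue of Markman's Theorem [for the Kummer moduli spaces]") and of Bülles 2020 §1.1 — the engine of
`Bulles2020_sheafModuli_isDominatedByPowers_surface` (`KummerModuliSpacesOfSheaves`, which lists "Markman's
diagonal theorem" under *What is NOT here* for want of a "generated subring" carrier; the carrier now exists:
`HilbertScheme.cupSubalgebra`, Li–Qin–Wang Def. 5.18), of the cell's barrier note
`run/shared/lean/pub/vhodge/BARRIER-NOTE-markman-diagonal-kummer.md` (Cor. 2 mechanism on `K × K`), and the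
print input "T2" of the crux idea `kummer-moduli-invariants-by-markman-on-m` (LEMMA P: the involution
`E ↦ (−1)^*E` of `M_H(v)` acts on `Hᵏ(M)` by `(−1)ᵏ`, because it acts so on these generators).
HONEST FRAMING: typed ≠ proved ≠ endorsed; one new named fact (a REFEREED theorem in print, unproved in the
tree); nothing here asserts the Hodge conjecture for any moduli space, `K_H(v)`, K3 surface or `Kumⁿ`-type
variety, nor `HC ∕ HC_AV ∕ W₆ ∕ HC_Kum4Type`.

## Source (read AT SOURCE this session; locators = `lit read arxiv:math/0009109`, 16 chunks)

E. Markman, *Generators of the cohomology ring of moduli spaces of sheaves on symplectic surfaces*,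
J. reine angew. Math. 544 (2002) 61–82 [`Markman2002Generators`; REFEREED].  §2 p0003:L3–L14: "Let `S` be a
K3 or abelian surface, `𝓛` an ample line bundle on `S`, and `𝓜 := 𝓜_𝓛(r,c₁,c₂)` the moduli space of
`𝓛`-stable sheaves of rank `r ≥ 0` and Chern classes `c₁` and `c₂`. `𝓜` is a smooth and symplectic
quasi-projective variety [Mukai]. When the rank is `1`, `𝓜` is isomorphic to the Hilbert scheme […] We do not
assume completeness of `𝓜` in the proof of Theorem 1"; L29–L30: "Assume that there exists a universal family
over `𝓜 × S` (this assumption is dropped in Section [semi-universal])".  **Thm. 1** (L32–L66): the class of the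
diagonal in `𝓜 × 𝓜` is `c_m[−𝓔xt^!_{π₁₃}(π₁₂^*ℰ′, π₂₃^*ℰ″)]`, `m = dim 𝓜`.  **Cor. 2** (L70–L74), VERBATIM:
"If `𝓜` is complete, then the Künneth factors of the Chern classes of any universal sheaf `ℰ` on `𝓜 × S`
generate the cohomology ring `H^*(𝓜, ℚ)`."  Proof (L76–L119): Grothendieck–Riemann–Roch writes the class of
the diagonal as `γ(ch ℰ′, ch ℰ″)`, a polynomial in the classes `p₁₃_*(p₁₂^*αⁱ · p₂₃^*βʲ) = Σ ±(∫_S …) u′ × u″`;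
"the left hand Künneth factors of `γ(ch(ℰ′), ch(ℰ″))` are contained in the subring generated by the Künneth
factors of `ch(ℰ′)`" (L118–L119), and `[Δ]_* = id`.  Rem. 3 (L120–L127): independence of the twist of `ℰ`
by `ℚ`-Cartier divisors.

## Rendering (tree carriers) and faithfulness

* "`𝓜` a complete moduli space of stable sheaves on `S` with a universal sheaf `ℰ`": the FINE moduli
  carriers of this directory — `AbelianSurfaceSheafModuli C A p H v M ℰ` (abelian surface; Yoshioka's clause
  `M̄ = M` included — an extra hypothesis, the WEAKER direction) resp. `K3SheafModuliUniversalFamily C S p H v M ℰ`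
  with `C` coherent-additive, `p` an integral generator of `H⁴`, `H` a polarisation class (EXACTLY the
  hypothesis block of `Bulles2020_sheafModuli_isDominatedByPowers_surface`, clause for clause) — together with
  `Motives.IsSmoothProjective d M` ("complete"; Mukai's smoothness is then a hypothesis, not used).  READING as
  for every record on these carriers (`K3SheafModuli` module docstring items 1–7): `C` = the Chern character,
  `p` = the point class, `H` = an ample class; the tree's `IsPolarizationClass` is wider than the ample cone —
  scope exactly as recorded for Bülles' fact: off the ample cone the positive-rank functor is empty for a
  non-nef `H` (no `M`), rank `1` is `Pic × Hilb` ("when the rank is `1`, `𝓜` is the Hilbert scheme"), and on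
  the nef boundary Markman's proof (universal family, stable ⇒ simple, Serre duality with `K_S = 0`,
  `𝓔xt`-vanishing) runs verbatim; no parameter value is known or suspected at which the statement fails.
* "the Künneth factors of the Chern classes of `ℰ`": for the class `Z_j := ch_j(ℰ) ∈ H^{2j}((S × M)(ℂ); ℂ)`
  (`C.ch (S ⊗ M) ℰ j`, transported to `M ⊗ S` along the swap `lift (snd M S) (fst M S) : M ⊗ S ⟶ S ⊗ M` so
  that `M` is the RECEIVING factor of the tree's `HodgeTheory.corrClassAction`), the classes
  `Z_j^*(c) = pr_{M*}(pr_S^* c ∪ Z_j) ∈ Hᵇ(M(ℂ); ℂ)`, `c ∈ Hᵃ(S(ℂ); ℂ)`, `a + 2j = b + 4` — by Poincaré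
  duality on `S` these are exactly the Künneth components of `Z_j` (the `u_s` of `Z_j = Σ_s u_s × a_s` over a
  basis `(a_s)` of `H^*(S)`, up to the dual basis).  Chern CLASSES vs. Chern CHARACTER: over `ℚ` the `cᵢ` are
  polynomials in the `ch_j` and conversely (Newton), and a Künneth component of a cup product is a sum of
  products of Künneth components of the factors, so the two generating sets generate the SAME subalgebra —
  the rendering with `ch_j` is equivalent to the printed one (and is the form the proof uses, L76–L119).
* "generate the cohomology ring `H^*(𝓜, ℚ)`": the sub-`ℂ`-algebra of the total cohomology
  `H^*(M(ℂ); ℂ) = ⨁ₖ Hᵏ` (`Hyperkaehler.totalCohomology`) generated by these classes — the smallest submodule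
  containing them and `1`, closed under the cup product (`HilbertScheme.cupSubalgebra`, Li–Qin–Wang Def. 5.18)
  — is everything (`= ⊤`).  `ℚ`-generation implies `ℂ`-generation (tensor up).  Orientations: `corrClassAction`
  is built on `ℂ`-orientations `μ` of `(M ⊗ S)(ℂ)` and `ν` of `M(ℂ)`; for the connected closed manifolds at
  hand any two differ by a non-zero scalar, under which each generator changes by a non-zero scalar and the
  generated subalgebra not at all — so the statement is made for EVERY pair of orientations with Poincaré
  duality (as `HodgeTheory.IsAlgebraicCorrespondence` quantifies existentially over the same data).
* WEAKER than print: complex coefficients; fine moduli (print: a universal family assumed in Cor. 2 — the same;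
  §"semi-universal" drops it — not rendered); untwisted sheaves.  FAITHFUL otherwise.  REFEREED.
  -- TODO(general form): Thm. 1 itself (the diagonal as `c_m(−𝓔xt^!)`, needs a K-theory ∕ relative-Ext carrier);
  -- the semi-universal version [Mar07]; Markman's integral generators.

## What is NOT here

Thm. 1 (the diagonal formula); the Kummer fibres `K_H(v)` (for which the VERBATIM analogue is false in
dimensions 4–10 by Betti count — `Hyperkaehler/GeneralizedKummerBettiNumbers` and the cell's barrier note —
and every twisted analogue is invisible to rational cohomology, `vhodge/lit-oqh/BARRIER-NOTE-twisted-diagonal-kummer.md`);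
any Hodge-conjecture consequence (Bülles' domination record already carries those).

## Content and D-0026 accounting

`kunnethGenerators` (a `def` with body: the generating set); ONE NAMED FACT
`Markman2002_kunnethFactors_generate_cohomology_sheafModuli` (+1; REFEREED theorem in print); kernel:
projections `.abelianSurface`, `.k3`, and `.mem_of_abelianSurface` (every total cohomology class of a fine
projective `M_H(v)` on an abelian surface lies in the subalgebra generated by the Künneth factors — the form
LEMMA P consumes).
-/

noncomputable section

open CategoryTheory MonoidalCategory CartesianMonoidalCategory
open Literature.AlgebraicTopology.SingularHomology

namespace Literature.AlgebraicGeometry.ModuliOfSheaves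

open HodgeTheory HilbertScheme
open Hyperkaehler (totalCohomology ofDegree)
open Motives (SchemeOver AbelianVariety IsSmoothProjective ComplexPoints)

/-! ### The generating set: Künneth factors of the Chern character of a family on `S × M` -/

/-- **The Künneth factors in `H^*(M(ℂ); ℂ)` of the Chern character of a sheaf `ℰ` on `S ⊗ M`** (`S` of
dimension `n`, `M` of dimension `m`), relative to `ℂ`-orientations `μ` of `(M ⊗ S)(ℂ)` and `ν` of `M(ℂ)`:
the homogeneous classes `Z_j^*(c) = pr_{M*}(pr_S^* c ∪ Z_j) ∈ Hᵇ(M(ℂ); ℂ)` for `Z_j = ch_j(ℰ)` transported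
to `M ⊗ S`, `c ∈ Hᵃ(S(ℂ); ℂ)`, `a + 2j = b + 2n`, placed in the total cohomology (`ofDegree`).  Markman's
"Künneth factors of the Chern classes of `ℰ`" generate the same subalgebra (module docstring).
[cite: Markman2002Generators, §1 p. 2 ("The Künneth factors of the Chern classes of a universal sheaf") and Cor. 2] -/
def kunnethGenerators (C : ChernCharacterBetti) {m n : ℕ} (S M : SchemeOver ℂ) (E : (S ⊗ M).left.Modules)
    (μ : HomologicalOrientation ℂ (ComplexPoints (M ⊗ S)) (2 * (m + n)))
    (ν : HomologicalOrientation ℂ (ComplexPoints M) (2 * m)) : Set (totalCohomology ℂ (ComplexPoints M)) :=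
  {x | ∃ (j a b q : ℕ) (hab : a + 2 * j = b + 2 * n) (hq : b + q = 2 * m) (c : complexBetti S a),
    x = ofDegree ℂ (ComplexPoints M) b
      (corrClassAction μ ν hab hq
        (complexBetti.map (lift (snd M S) (fst M S)) (2 * j) (C.ch (S ⊗ M) E j)) c)}

/-- Unfolding of `kunnethGenerators`. [cite: Markman2002Generators, Cor. 2] -/
theorem mem_kunnethGenerators_iff (C : ChernCharacterBetti) {m n : ℕ} {S M : SchemeOver ℂ}
    {E : (S ⊗ M).left.Modules} {μ : HomologicalOrientation ℂ (ComplexPoints (M ⊗ S)) (2 * (m + n))}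
    {ν : HomologicalOrientation ℂ (ComplexPoints M) (2 * m)} {x : totalCohomology ℂ (ComplexPoints M)} :
    x ∈ kunnethGenerators C S M E μ ν ↔
      ∃ (j a b q : ℕ) (hab : a + 2 * j = b + 2 * n) (hq : b + q = 2 * m) (c : complexBetti S a),
        x = ofDegree ℂ (ComplexPoints M) b
          (corrClassAction μ ν hab hq
            (complexBetti.map (lift (snd M S) (fst M S)) (2 * j) (C.ch (S ⊗ M) E j)) c) :=
  Iff.rfl

/-! ### The named fact -/

/-- **Markman 2002, Cor. 2 (REFEREED): "If `𝓜` is complete, then the Künneth factors of the Chern classes of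
any universal sheaf `ℰ` on `𝓜 × S` generate the cohomology ring `H^*(𝓜, ℚ)`"** — for `S` a K3 or abelian
surface and `𝓜` a moduli space of stable sheaves on `S` [§2: "`S` a K3 or abelian surface … the moduli space
of `𝓛`-stable sheaves"].  Rendering (module docstring): clause (i) `S` a K3 surface and `(M, ℰ)` a FINE
moduli space `K3SheafModuliUniversalFamily C S p H v M ℰ` (`C` coherent-additive, `p` an integral generator of
`H⁴`, `H` a polarisation class); clause (ii) `S = A` an abelian surface and `(M, ℰ)` as in
`AbelianSurfaceSheafModuli C A p H v M ℰ`; in both, `M` smooth projective of dimension `d` ("complete"),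
and for ALL `ℂ`-orientations `μ`, `ν` with Poincaré duality the sub-`ℂ`-algebra of `H^*(M(ℂ); ℂ)` generated
by the Künneth factors of `ch(ℰ)` (`cupSubalgebra … (kunnethGenerators …)`) is all of `H^*(M(ℂ); ℂ)`.
WEAKER than print (complex coefficients) and otherwise FAITHFUL at the classical reading `C = ch`, `p = [pt]`,
`H` ample; a THEOREM in print, unproved in the tree; one named fact (D-0014).
[cite: Markman2002Generators, Cor. 2 (§2; arXiv:math/0009109 p. 3), with Thm. 1 and its GRR proof] -/
def Markman2002_kunnethFactors_generate_cohomology_sheafModuli : Prop :=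
  (∀ (C : ChernCharacterBetti) (S : SchemeOver ℂ) (p : complexBetti S (2 * 2)) (H : complexBetti S (2 * 1))
      (v : Surfaces.MukaiSpace S) (M : SchemeOver ℂ) (E : (S ⊗ M).left.Modules) (d : ℕ),
      C.CoherentAdditiveOn S →
      (IsIntegralClass p ∧ ∀ q : complexBetti S (2 * 2), IsIntegralClass q → ∃ m : ℤ, q = m • p) →
      IsPolarizationClass 2 S H →
      K3SheafModuliUniversalFamily C S p H v M E → IsSmoothProjective d M →
      ∀ (μ : HomologicalOrientation ℂ (ComplexPoints (M ⊗ S)) (2 * (d + 2)))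
        (ν : HomologicalOrientation ℂ (ComplexPoints M) (2 * d)),
        μ.HasPoincareDuality → ν.HasPoincareDuality →
        cupSubalgebra ℂ (ComplexPoints M) (kunnethGenerators C S M E μ ν) = ⊤) ∧
  ∀ (C : ChernCharacterBetti) (A : AbelianVariety ℂ) (p : complexBetti A.X (2 * 2))
    (H : complexBetti A.X (2 * 1)) (v : (i : ℕ) → complexBetti A.X (2 * i)) (M : SchemeOver ℂ)
    (E : (A.X ⊗ M).left.Modules) (d : ℕ),
    AbelianSurfaceSheafModuli C A p H v M E → IsSmoothProjective d M →
    ∀ (μ : HomologicalOrientation ℂ (ComplexPoints (M ⊗ A.X)) (2 * (d + 2)))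
      (ν : HomologicalOrientation ℂ (ComplexPoints M) (2 * d)),
      μ.HasPoincareDuality → ν.HasPoincareDuality →
      cupSubalgebra ℂ (ComplexPoints M) (kunnethGenerators C A.X M E μ ν) = ⊤

namespace Markman2002_kunnethFactors_generate_cohomology_sheafModuli

/-- Clause (ii): abelian surfaces. [cite: Markman2002Generators, Cor. 2] -/
theorem abelianSurface (h : Markman2002_kunnethFactors_generate_cohomology_sheafModuli)
    {C : ChernCharacterBetti} {A : AbelianVariety ℂ} {p : complexBetti A.X (2 * 2)}
    {H : complexBetti A.X (2 * 1)} {v : (i : ℕ) → complexBetti A.X (2 * i)} {M : SchemeOver ℂ}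
    {E : (A.X ⊗ M).left.Modules} {d : ℕ} (hM : AbelianSurfaceSheafModuli C A p H v M E)
    (hMd : IsSmoothProjective d M) (μ : HomologicalOrientation ℂ (ComplexPoints (M ⊗ A.X)) (2 * (d + 2)))
    (ν : HomologicalOrientation ℂ (ComplexPoints M) (2 * d)) (hμ : μ.HasPoincareDuality)
    (hν : ν.HasPoincareDuality) :
    cupSubalgebra ℂ (ComplexPoints M) (kunnethGenerators C A.X M E μ ν) = ⊤ :=
  h.2 C A p H v M E d hM hMd μ ν hμ hν

/-- Clause (i): K3 surfaces. [cite: Markman2002Generators, Cor. 2] -/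
theorem k3 (h : Markman2002_kunnethFactors_generate_cohomology_sheafModuli) {C : ChernCharacterBetti}
    {S : SchemeOver ℂ} {p : complexBetti S (2 * 2)} {H : complexBetti S (2 * 1)} {v : Surfaces.MukaiSpace S}
    {M : SchemeOver ℂ} {E : (S ⊗ M).left.Modules} {d : ℕ} (hC : C.CoherentAdditiveOn S)
    (hp : IsIntegralClass p ∧ ∀ q : complexBetti S (2 * 2), IsIntegralClass q → ∃ m : ℤ, q = m • p)
    (hH : IsPolarizationClass 2 S H) (hM : K3SheafModuliUniversalFamily C S p H v M E)
    (hMd : IsSmoothProjective d M) (μ : HomologicalOrientation ℂ (ComplexPoints (M ⊗ S)) (2 * (d + 2)))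
    (ν : HomologicalOrientation ℂ (ComplexPoints M) (2 * d)) (hμ : μ.HasPoincareDuality)
    (hν : ν.HasPoincareDuality) :
    cupSubalgebra ℂ (ComplexPoints M) (kunnethGenerators C S M E μ ν) = ⊤ :=
  h.1 C S p H v M E d hC hp hH hM hMd μ ν hμ hν

/-- **Every total cohomology class of a fine projective moduli space `M_H(v)` on an abelian surface lies in
the subalgebra generated by the Künneth factors of `ch(ℰ)`** (clause (ii), membership form — the shape the
parity argument for the involution `E ↦ (−1)^*E` consumes: two ring endomorphisms of `H^*(M)` agreeing on
these generators agree).  Kernel, modulo the record `h`. [cite: Markman2002Generators, Cor. 2] -/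
theorem mem_of_abelianSurface (h : Markman2002_kunnethFactors_generate_cohomology_sheafModuli)
    {C : ChernCharacterBetti} {A : AbelianVariety ℂ} {p : complexBetti A.X (2 * 2)}
    {H : complexBetti A.X (2 * 1)} {v : (i : ℕ) → complexBetti A.X (2 * i)} {M : SchemeOver ℂ}
    {E : (A.X ⊗ M).left.Modules} {d : ℕ} (hM : AbelianSurfaceSheafModuli C A p H v M E)
    (hMd : IsSmoothProjective d M) (μ : HomologicalOrientation ℂ (ComplexPoints (M ⊗ A.X)) (2 * (d + 2)))
    (ν : HomologicalOrientation ℂ (ComplexPoints M) (2 * d)) (hμ : μ.HasPoincareDuality)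
    (hν : ν.HasPoincareDuality) (x : totalCohomology ℂ (ComplexPoints M)) :
    x ∈ cupSubalgebra ℂ (ComplexPoints M) (kunnethGenerators C A.X M E μ ν) := by
  rw [h.abelianSurface hM hMd μ ν hμ hν]
  exact Submodule.mem_top

/-- **A cup-closed submodule containing `1` and the Künneth factors is everything** (clause (ii), minimality
form: the way "generated by" is used downstream — e.g. the fixed space of a ring automorphism fixing the
generators).  Kernel, modulo the record `h`. [cite: Markman2002Generators, Cor. 2] -/
theorem eq_top_of_abelianSurface (h : Markman2002_kunnethFactors_generate_cohomology_sheafModuli)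
    {C : ChernCharacterBetti} {A : AbelianVariety ℂ} {p : complexBetti A.X (2 * 2)}
    {H : complexBetti A.X (2 * 1)} {v : (i : ℕ) → complexBetti A.X (2 * i)} {M : SchemeOver ℂ}
    {E : (A.X ⊗ M).left.Modules} {d : ℕ} (hM : AbelianSurfaceSheafModuli C A p H v M E)
    (hMd : IsSmoothProjective d M) (μ : HomologicalOrientation ℂ (ComplexPoints (M ⊗ A.X)) (2 * (d + 2)))
    (ν : HomologicalOrientation ℂ (ComplexPoints M) (2 * d)) (hμ : μ.HasPoincareDuality)
    (hν : ν.HasPoincareDuality) {W : Submodule ℂ (totalCohomology ℂ (ComplexPoints M))}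
    (hG : kunnethGenerators C A.X M E μ ν ⊆ W)
    (h1 : ofDegree ℂ (ComplexPoints M) 0 (singularCohomology.one ℂ (ComplexPoints M)) ∈ W)
    (hW : Hyperkaehler.IsCupClosed W) : W = ⊤ :=
  top_le_iff.1 ((h.abelianSurface hM hMd μ ν hμ hν).symm.le.trans (cupSubalgebra_le hG h1 hW))

end Markman2002_kunnethFactors_generate_cohomology_sheafModuli

end Literature.AlgebraicGeometry.ModuliOfSheaves

end
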